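import Summits.BirchSwinnertonDyer.BirchSwinnertonDyer.Theorems.CMKolyvaginAtInertTwoGenusDefectShaCapstoneAtTwo
import Summits.BirchSwinnertonDyer.BirchSwinnertonDyer.Theorems.CMKolyvaginAtInertTwoGenusDefectLadderFrameAtTwo
import Summits.BirchSwinnertonDyer.BirchSwinnertonDyer.Theorems.CMKolyvaginAtInertTwoLowerStubLowerAtTwo
import HarnessLib

/-!
# Route `CMKolyvaginAtInertTwo`, crux `CMKolyvaginExactAtInertTwo` (stmt-BirchSwinnertonDyer-24277) —
# A LEVEL-4 GROSS WITNESS FORCES `2^{2M₀}·2^{Σ} ≤ #Ш(E_K)(2)·2`; WITH THE CRUX, `Σ ≤ 1`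

Seat `bsd-line-cmk2-p1` g20 (cell `bsd-print-cf2`), `--supports stmt-BirchSwinnertonDyer-24277` (helper; closes nothing).
THEOREMS ONLY (no definition, no named fact, no `sorry`).  BSD is NOT proved by this; the crux is NOT closed here.

Step (e) of memo `MEMO-genus-triviality.md` §6.2 — the END of the threading.  `Σ` is the genus defect
`Σ_{q ∣ d_K} ([χ_q(Δ) = −1] + 2·[χ_q(Δ) = 1 ∧ 2 ∣ a_q]) = ord₂ C(W^{(d_K)})` of g18's composite supply.

* `twinShaLaddersQ_of_grossWitness` — g19's `KolyvaginLowerTwo.twinShaLadders_of_grossWitness` (the two ℚ-side ladders of gk2's stub L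
  on H₂ from a level-`4` Gross witness, sockets C1c / C2b / gk2-p5 supplied) with values IN `Ш(W/ℚ)` and IN `Ш(W^{(d_K)}/ℚ)`:
  the classes `2^{L−M′}c_L(n)` are doubles of eigenclasses Selmer at `d_K` (one spare level), so their descents have no genus
  component (Dokchitser–Dokchitser) — files `…GenusDefectSha{Descent,Rungs,LaddersOfSupplies,Capstone}AtTwo`.
* `pow_mul_pow_sum_defect_le_card_sha_two_baseChange_of_grossWitness_of_printedInputs` — **`2^{2M₀}·2^{Σ} ≤ #Ш(E_K)[2^∞]·2`**
  on H₂ (ANY odd `d_K ≠ −3`) from a level-`4` Gross witness, modulo GZ / GZK / modularity / Milne and Gross 3.7 (2) at `(W, K)`: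
  the ladders fed to `two_pow_mul_two_pow_sum_defect_le_of_shaValuedLadders` (zero genus budgets on both sides + g15's count identity).
  For prime `|d_K|` (`Σ = 1`) this is g19's lower half `2^{2M₀} ≤ #Ш(E_K)[2^∞]`; for `Σ ≥ 2` it EXCEEDS the crux's value `2^{2M₀}`.
* `sum_defect_le_one_of_cmKolyvaginExact_of_grossWitness` — the crux `CMKolyvaginExactAtInertTwo` (hypothesis `hX`), instantiated
  at a primitive certificate on the same frame, then forces `Σ ≤ 1`;
* `not_cmKolyvaginExactAtInertTwo_of_grossWitness_of_two_le_sum_defect` — contrapositive: ONE H₂ frame with a primitive certificate,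
  a level-`4` Gross witness and `Σ ≥ 2` REFUTES the crux as stated (modulo the five prints).  No such frame is exhibited here (that is a
  computation / a Čebotarev-at-level-`2^{L+k}` existence question — crux 24648's territory); the theorem records exactly what a
  numerical search has to produce, and why the route's lower-half strategy (deep ladders) cannot prove 24277 when `Σ ≥ 2`.
* `card_primaryComponent_sha_two_baseChange_mul_two_eq_of_grossWitness_of_printedInputs` — with g18's composite upper bound:
  **`#Ш(E_K)[2^∞]·2 = 2^{2M₀+Σ}` for every odd `d_K ≠ −3` on H₂ given a level-`4` Gross witness** (the BSD-predicted value; the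
  corrected form of the crux for composite `d_K`).

References: [McCallumLMS1991] §5 Prop. 5.2, Thm. 5.4, Cor. 5.6; [GrossLMS1991] Thm. 1.3, Prop. 3.7 (2), §5, Prop. 6.2;
[DokchitserDokchitserAnnals2010] Lemma 4.14; [Kramer1981] Prop. 3; [Milne1972ArithmeticAV] Thm. 1.
-/

set_option autoImplicit false
-- the Theorems namespace of this sub repeats the summit name by design (D-0017 nested layout)
set_option linter.dupNamespace false

noncomputable section

open scoped Classical

namespace Summit.BirchSwinnertonDyer.BirchSwinnertonDyer.Theorems.KolyvaginGenusTwo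

open WeierstrassCurve NumberField IsDedekindDomain Field AddSubgroup
open Literature.NumberTheory.EllipticCurves Literature.NumberTheory.GaloisRepresentations
open Literature.NumberTheory.EllipticCurves.ModularForms Literature.NumberTheory.EllipticCurves.RingClassField
open Literature.NumberTheory.EllipticCurves.GrossLMS1991 (prop37_2_reductionCongruence_inert)
open Summit.BirchSwinnertonDyer.BirchSwinnertonDyer.Theses.CMKolyvaginAtInertTwo (CMKolyvaginExactAtInertTwo)
open Summit.BirchSwinnertonDyer.BirchSwinnertonDyer.Theorems.GenusExact
open Summit.BirchSwinnertonDyer.BirchSwinnertonDyer.Theorems.KolyvaginLowerTwo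
open Summit.BirchSwinnertonDyer.Rank1Residual

/-! ## §1 The two Ш(·/ℚ)-valued ladders on H₂ from a level-4 Gross witness -/

/-- **THE TWO `Ш(·/ℚ)`-VALUED LADDERS ON H₂ FROM A LEVEL-`4` GROSS WITNESS, modulo Gross 3.7 (2) at `(W, K)` and `rank E(K) = 1`.**
g19's `twinShaLadders_of_grossWitness` (B2's `kolyvaginSuppliesAtTwo_of_deepSwap` over the margin-`k` class, sockets: C1c
`hbot_socket_margin_of_three_le`, C2b `deepSwap_socket`, gk2-p5 `hK_socket_margin`) fed to the Ш-valued capstone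
`twinShaLaddersQ_of_kolyvaginSuppliesAtTwo_of_double`.  Level `L ≥ 2M₀ + 12`, depth `k ≥ 1`; witness `n₀` square-free of Zhang–Kolyvagin
primes of index `≥ 2` with `FrobEqFrobInfty W K 4`, a datum `e₀` with `addOrderOf c₂(e₀) = 4`.
[cite: McCallumLMS1991, §5 Prop. 5.2, Thm. 5.4] [cite: GrossLMS1991, Thm. 1.3, Prop. 3.7 (2), §4 (4.1), Prop. 5.3, Prop. 6.2]
[cite: DokchitserDokchitserAnnals2010, Lemma 4.14 (proof)] -/
theorem twinShaLaddersQ_of_grossWitness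
    (W : WeierstrassCurve ℚ) [W.IsElliptic] [W.IsGloballyMinimal] [NeZero (W.conductorNorm ℤ)]
    (hCM : W.HasCM) (hin : Rank1Residual.CMInert W 2) (hρ2 : W.HasSurjectiveModNGaloisRep 2)
    (hT : Odd W.tamagawaProduct) (K : Type) [Field K] [NumberField K] (hIQ : IsImaginaryQuadratic K)
    (hodd : Odd (NumberField.discr K)) (h3 : NumberField.discr K ≠ -3) (hHe : SatisfiesHeegnerHypothesis (W.conductorNorm ℤ) K)
    (h37 : prop37_2_reductionCongruence_inert (W.conductorNorm ℤ) W K)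
    (Dt : ModularParametrizationData W (W.conductorNorm ℤ)) (β : ℤ) (ι : K →+* ℂ) (d₁ : KolyvaginHeegnerData Dt β ι 1)
    (hy : ¬ IsOfFinAddOrder d₁.derivedPoint) (hrk1 : (W.baseChange K).mordellWeilRank = 1) (M₀ : ℕ)
    (hM₀ : ∃ Q : (W.baseChange (ringClassField K ι 1)).toAffine.Point, ((2 ^ M₀ : ℕ) : ℤ) • Q = d₁.derivedPoint)
    (hndiv : ¬ ∃ Q : (W.baseChange (ringClassField K ι 1)).toAffine.Point, ((2 ^ (M₀ + 1) : ℕ) : ℤ) • Q = d₁.derivedPoint)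
    [(W.quadraticTwist (NumberField.discr K : ℚ)).IsElliptic]
    {L k : ℕ} (hL : 2 * M₀ + 12 ≤ L) (hk : 1 ≤ k)
    {n₀ : ℕ} (hn₀ : Squarefree n₀)
    (hn₀K : ∀ q ∈ n₀.primeFactors, Zhang2014.IsKolyvaginPrime (W.conductorNorm ℤ) W K 2 q ∧ 2 ≤ Zhang2014.kolyvaginIndex W 2 q ∧
      FrobEqFrobInfty W K (2 ^ 2) q)
    (e₀ : KolyvaginHeegnerData Dt β ι n₀) (he₀ : addOrderOf (e₀.kolyvaginClass Nat.prime_two 2) = 2 ^ 2) :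
    ∃ (T : ℕ) (M : ℕ → ℕ), (∀ j, M (j + 1) ≤ M j) ∧ M 0 = M₀ ∧ M (2 * T) = 0 ∧
      (∀ m < T, ∃ x : Fin (2 * m + 2) → W.galH1, (∀ i, x i ∈ W.sha) ∧
        (∀ i, addOrderOf (x i) = 2 ^ (M (2 * m) - M (2 * m + 1))) ∧
        ∀ c : Fin (2 * m + 2) → ℤ, ∑ i, c i • x i = 0 → ∀ i, ((2 ^ (M (2 * m) - M (2 * m + 1)) : ℕ) : ℤ) ∣ c i) ∧
      (∀ m < T, ∃ x : Fin (2 * m + 2) → (W.quadraticTwist (NumberField.discr K : ℚ)).galH1,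
        (∀ i, x i ∈ (W.quadraticTwist (NumberField.discr K : ℚ)).sha) ∧
        (∀ i, addOrderOf (x i) = 2 ^ (M (2 * m + 1) - M (2 * m + 2))) ∧
        ∀ c : Fin (2 * m + 2) → ℤ, ∑ i, c i • x i = 0 → ∀ i, ((2 ^ (M (2 * m + 1) - M (2 * m + 2)) : ℕ) : ℤ) ∣ c i) := by
  haveI : ∀ j : ℕ, NumberField (ringClassField K ι j) := JET.numberField_ringClassField K hIQ ι
  have hΔ : W.Δ < 0 := KolyvaginEigenTwo.Δ_neg_of_cmInert_two W hCM hin hρ2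
  refine twinShaLaddersQ_of_kolyvaginSuppliesAtTwo_of_double W Dt β ι hρ2 hT hΔ hIQ hodd h3 hHe h37 d₁ hy hrk1 M₀ hndiv fun τ hτ ↦ ?_
  obtain ⟨R, Mr, h1, h2, h3', h4, h5⟩ := kolyvaginSuppliesAtTwo_of_deepSwap W hCM hin hρ2 hT hIQ hodd h3 hHe h37 τ hτ
    Dt β ι d₁ M₀ hM₀ hndiv (L := L) (by omega) k
    (fun q ↦ L + k ≤ Zhang2014.kolyvaginIndex W 2 q ∧ FrobEqFrobInfty W K (2 ^ (L + k)) q) (fun q _ hidx hF ↦ ⟨hidx, hF⟩)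
    (hbot_socket_margin_of_three_le W hCM hin hρ2 hT hIQ hodd h3 hHe h37 Dt β ι (L := L) (by omega) k (by omega) _
      (fun q _ hidx hF ↦ ⟨hidx, hF⟩) hn₀ hn₀K e₀ he₀)
    (deepSwap_socket W hCM hin hT hρ2 hIQ hodd h3 hHe h37 τ hτ Dt β ι hL hk)
    (fun r ℓ hℓ C hC ↦ PlusDescent.hK_socket_margin W hΔ hIQ hτ (L := L) (by omega) r k ℓ hℓ C hC)
  exact ⟨L, R, Mr, by omega, h1, h2, h3', h4, h5⟩

/-! ## §2 `2^{2M₀}·2^{Σ} ≤ #Ш(E_K)(2)·2` from a Gross witness; with the crux, `Σ ≤ 1` -/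

/-- **`2^{2M₀}·2^{Σ} ≤ #Ш(E_K)[2^∞]·2` ON H₂ (any odd `d_K ≠ −3`) FROM A LEVEL-`4` GROSS WITNESS**, modulo GZ (24148) / GZK (19921) /
modularity (19273) / Milne (24149) and Gross 3.7 (2) at `(W, K)`: the Ш-valued ladders of §1 (with `rank E(K) = 1` from the prints) fed
to `two_pow_mul_two_pow_sum_defect_le_of_shaValuedLadders`.  For `Σ = 1` (prime `|d_K|`) this is the lower half of the crux; for
`Σ ≥ 2` it is STRICTLY MORE than the crux allows. [cite: McCallumLMS1991, §5 Thm. 5.4, Cor. 5.6] [cite: Kramer1981, Prop. 3]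
[cite: DokchitserDokchitserAnnals2010, Lemma 4.14 (proof)] [cite: Milne1972ArithmeticAV, Thm. 1] -/
theorem pow_mul_pow_sum_defect_le_card_sha_two_baseChange_of_grossWitness_of_printedInputs
    (hGZ : ∀ (N : ℕ) [NeZero N] (W : WeierstrassCurve ℚ) (K : Type) [Field K] [NumberField K], gross_zagier N W K)
    (hGZK : rank_eq_analyticRank_of_analyticRank_le_one) (hmod : hasEntireLFunction_rat)
    (hMilneC : Milne1972.bsdQuotient_baseChange_quadratic_anyModel)
    (W : WeierstrassCurve ℚ) [W.IsElliptic] [W.IsGloballyMinimal] [NeZero (W.conductorNorm ℤ)]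
    (hCM : W.HasCM) (hin : Rank1Residual.CMInert W 2) (hρ2 : W.HasSurjectiveModNGaloisRep 2)
    (hT : Odd W.tamagawaProduct) (K : Type) [Field K] [NumberField K] (hIQ : IsImaginaryQuadratic K)
    (hodd : Odd (NumberField.discr K)) (h3 : NumberField.discr K ≠ -3) (hHe : SatisfiesHeegnerHypothesis (W.conductorNorm ℤ) K)
    (h37 : prop37_2_reductionCongruence_inert (W.conductorNorm ℤ) W K)
    (Dt : ModularParametrizationData W (W.conductorNorm ℤ)) (β : ℤ) (ι : K →+* ℂ) (d₁ : KolyvaginHeegnerData Dt β ι 1)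
    (hy : ¬ IsOfFinAddOrder d₁.derivedPoint) (M₀ : ℕ)
    (hM₀ : ∃ Q : (W.baseChange (ringClassField K ι 1)).toAffine.Point, ((2 ^ M₀ : ℕ) : ℤ) • Q = d₁.derivedPoint)
    (hndiv : ¬ ∃ Q : (W.baseChange (ringClassField K ι 1)).toAffine.Point, ((2 ^ (M₀ + 1) : ℕ) : ℤ) • Q = d₁.derivedPoint)
    {L k : ℕ} (hL : 2 * M₀ + 12 ≤ L) (hk : 1 ≤ k)
    {n₀ : ℕ} (hn₀ : Squarefree n₀)
    (hn₀K : ∀ q ∈ n₀.primeFactors, Zhang2014.IsKolyvaginPrime (W.conductorNorm ℤ) W K 2 q ∧ 2 ≤ Zhang2014.kolyvaginIndex W 2 q ∧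
      FrobEqFrobInfty W K (2 ^ 2) q)
    (e₀ : KolyvaginHeegnerData Dt β ι n₀) (he₀ : addOrderOf (e₀.kolyvaginClass Nat.prime_two 2) = 2 ^ 2) :
    2 ^ (2 * M₀) * 2 ^ ∑ q ∈ (NumberField.discr K).natAbs.primeFactors,
        ((if jacobiSym W.Δ.num q = -1 then 1 else 0) +
          (if jacobiSym W.Δ.num q = 1 ∧ Even (W.frobeniusTrace q) then 2 else 0)) ≤
      Nat.card (AddCommGroup.primaryComponent (W.baseChange K).sha 2) * 2 := by
  have hD0 : (NumberField.discr K : ℚ) ≠ 0 := by exact_mod_cast NumberField.discr_ne_zero K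
  haveI hEt : (W.quadraticTwist (NumberField.discr K : ℚ)).IsElliptic := W.isElliptic_quadraticTwist hD0
  have hrk1 : (W.baseChange K).mordellWeilRank = 1 :=
    mordellWeilRank_baseChange_eq_one_of_facts hGZ hGZK hmod W K hIQ hHe Dt β ι d₁ hy
  obtain ⟨T, M, hM, hM0, hMT, hfam, hfam'⟩ := twinShaLaddersQ_of_grossWitness W hCM hin hρ2 hT K hIQ hodd h3 hHe h37 Dt β ι d₁ hy
    hrk1 M₀ hM₀ hndiv hL hk hn₀ hn₀K e₀ he₀
  exact two_pow_mul_two_pow_sum_defect_le_of_shaValuedLadders W hGZ hGZK hmod hMilneC hCM hin hρ2 hIQ hodd hHe Dt β ι d₁ hy M₀ T M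
    hM hM0 hMT hfam hfam'

/-- **THE CRUX, A PRIMITIVE CERTIFICATE AND A LEVEL-`4` GROSS WITNESS TOGETHER FORCE `Σ ≤ 1`** (modulo the five prints): the crux
(hypothesis `hX`) evaluates `#Ш(E_K)(2) = 2^{2M₀}` at the certificate `(n, d)`; the witness gives `2^{2M₀}·2^{Σ} ≤ #Ш(E_K)(2)·2`.
[cite: McCallumLMS1991, §5 Thm. 5.4, Cor. 5.6] [cite: DokchitserDokchitserAnnals2010, Lemma 4.14 (proof)] [cite: Kramer1981, Prop. 3] -/
theorem sum_defect_le_one_of_cmKolyvaginExact_of_grossWitness (hX : CMKolyvaginExactAtInertTwo)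
    (hGZ : ∀ (N : ℕ) [NeZero N] (W : WeierstrassCurve ℚ) (K : Type) [Field K] [NumberField K], gross_zagier N W K)
    (hGZK : rank_eq_analyticRank_of_analyticRank_le_one) (hmod : hasEntireLFunction_rat)
    (hMilneC : Milne1972.bsdQuotient_baseChange_quadratic_anyModel)
    (W : WeierstrassCurve ℚ) [W.IsElliptic] [W.IsGloballyMinimal] [NeZero (W.conductorNorm ℤ)]
    (hCM : W.HasCM) (hin : Rank1Residual.CMInert W 2) (hρ2 : W.HasSurjectiveModNGaloisRep 2)
    (hT : Odd W.tamagawaProduct) (K : Type) [Field K] [NumberField K] (hIQ : IsImaginaryQuadratic K)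
    (hodd : Odd (NumberField.discr K)) (h3 : NumberField.discr K ≠ -3) (hHe : SatisfiesHeegnerHypothesis (W.conductorNorm ℤ) K)
    (hns₁ : ¬ IsSquare ((NumberField.discr K : ℚ) * -|W.Δ|)) (hns₂ : ¬ IsSquare ((NumberField.discr K : ℚ) * (-(2 * |W.Δ|))))
    (h37 : prop37_2_reductionCongruence_inert (W.conductorNorm ℤ) W K)
    (Dt : ModularParametrizationData W (W.conductorNorm ℤ)) (β : ℤ) (ι : K →+* ℂ) (d₁ : KolyvaginHeegnerData Dt β ι 1)
    (hy : ¬ IsOfFinAddOrder d₁.derivedPoint) (M₀ : ℕ)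
    (hM₀ : ∃ Q : (W.baseChange (ringClassField K ι 1)).toAffine.Point, ((2 ^ M₀ : ℕ) : ℤ) • Q = d₁.derivedPoint)
    (hndiv : ¬ ∃ Q : (W.baseChange (ringClassField K ι 1)).toAffine.Point, ((2 ^ (M₀ + 1) : ℕ) : ℤ) • Q = d₁.derivedPoint)
    {n : ℕ} (d : KolyvaginHeegnerData Dt β ι n) (hn : Squarefree n)
    (hKoly : ∀ ℓ ∈ n.primeFactors, Zhang2014.IsKolyvaginPrime (W.conductorNorm ℤ) W K 2 ℓ ∧ Rank1Residual.CMInert W ℓ)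
    (hPn : ¬ ∃ Q : (W.baseChange (ringClassField K ι n)).toAffine.Point, (2 : ℤ) • Q = d.derivedPoint)
    {L k : ℕ} (hL : 2 * M₀ + 12 ≤ L) (hk : 1 ≤ k)
    {n₀ : ℕ} (hn₀ : Squarefree n₀)
    (hn₀K : ∀ q ∈ n₀.primeFactors, Zhang2014.IsKolyvaginPrime (W.conductorNorm ℤ) W K 2 q ∧ 2 ≤ Zhang2014.kolyvaginIndex W 2 q ∧
      FrobEqFrobInfty W K (2 ^ 2) q)
    (e₀ : KolyvaginHeegnerData Dt β ι n₀) (he₀ : addOrderOf (e₀.kolyvaginClass Nat.prime_two 2) = 2 ^ 2) :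
    ∑ q ∈ (NumberField.discr K).natAbs.primeFactors,
        ((if jacobiSym W.Δ.num q = -1 then 1 else 0) +
          (if jacobiSym W.Δ.num q = 1 ∧ Even (W.frobeniusTrace q) then 2 else 0)) ≤ 1 := by
  have hD0 : (NumberField.discr K : ℚ) ≠ 0 := by exact_mod_cast NumberField.discr_ne_zero K
  haveI hEt : (W.quadraticTwist (NumberField.discr K : ℚ)).IsElliptic := W.isElliptic_quadraticTwist hD0
  have hrk1 : (W.baseChange K).mordellWeilRank = 1 :=
    mordellWeilRank_baseChange_eq_one_of_facts hGZ hGZK hmod W K hIQ hHe Dt β ι d₁ hy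
  obtain ⟨T, M, hM, hM0, hMT, hfam, hfam'⟩ := twinShaLaddersQ_of_grossWitness W hCM hin hρ2 hT K hIQ hodd h3 hHe h37 Dt β ι d₁ hy
    hrk1 M₀ hM₀ hndiv hL hk hn₀ hn₀K e₀ he₀
  exact sum_defect_le_one_of_cmKolyvaginExact_of_shaValuedLadders W hX hGZ hGZK hmod hMilneC hCM hin hρ2 hT hIQ hodd h3 hHe hns₁ hns₂
    Dt β ι d₁ hy M₀ hM₀ hndiv d hn hKoly hPn T M hM hM0 hMT hfam hfam'

/-- **CONTRAPOSITIVE: AN H₂ FRAME WITH A PRIMITIVE CERTIFICATE, A LEVEL-`4` GROSS WITNESS AND `Σ ≥ 2` REFUTES THE CRUX AS STATED**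
(modulo GZ / GZK / modularity / Milne and Gross 3.7 (2) at the frame).  No such frame is constructed here. [cite: McCallumLMS1991, §5 Thm. 5.4]
[cite: DokchitserDokchitserAnnals2010, Lemma 4.14 (proof)] [cite: Kramer1981, Prop. 3] -/
theorem not_cmKolyvaginExactAtInertTwo_of_grossWitness_of_two_le_sum_defect
    (hGZ : ∀ (N : ℕ) [NeZero N] (W : WeierstrassCurve ℚ) (K : Type) [Field K] [NumberField K], gross_zagier N W K)
    (hGZK : rank_eq_analyticRank_of_analyticRank_le_one) (hmod : hasEntireLFunction_rat)
    (hMilneC : Milne1972.bsdQuotient_baseChange_quadratic_anyModel)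
    (W : WeierstrassCurve ℚ) [W.IsElliptic] [W.IsGloballyMinimal] [NeZero (W.conductorNorm ℤ)]
    (hCM : W.HasCM) (hin : Rank1Residual.CMInert W 2) (hρ2 : W.HasSurjectiveModNGaloisRep 2)
    (hT : Odd W.tamagawaProduct) (K : Type) [Field K] [NumberField K] (hIQ : IsImaginaryQuadratic K)
    (hodd : Odd (NumberField.discr K)) (h3 : NumberField.discr K ≠ -3) (hHe : SatisfiesHeegnerHypothesis (W.conductorNorm ℤ) K)
    (hns₁ : ¬ IsSquare ((NumberField.discr K : ℚ) * -|W.Δ|)) (hns₂ : ¬ IsSquare ((NumberField.discr K : ℚ) * (-(2 * |W.Δ|))))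
    (h37 : prop37_2_reductionCongruence_inert (W.conductorNorm ℤ) W K)
    (Dt : ModularParametrizationData W (W.conductorNorm ℤ)) (β : ℤ) (ι : K →+* ℂ) (d₁ : KolyvaginHeegnerData Dt β ι 1)
    (hy : ¬ IsOfFinAddOrder d₁.derivedPoint) (M₀ : ℕ)
    (hM₀ : ∃ Q : (W.baseChange (ringClassField K ι 1)).toAffine.Point, ((2 ^ M₀ : ℕ) : ℤ) • Q = d₁.derivedPoint)
    (hndiv : ¬ ∃ Q : (W.baseChange (ringClassField K ι 1)).toAffine.Point, ((2 ^ (M₀ + 1) : ℕ) : ℤ) • Q = d₁.derivedPoint)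
    {n : ℕ} (d : KolyvaginHeegnerData Dt β ι n) (hn : Squarefree n)
    (hKoly : ∀ ℓ ∈ n.primeFactors, Zhang2014.IsKolyvaginPrime (W.conductorNorm ℤ) W K 2 ℓ ∧ Rank1Residual.CMInert W ℓ)
    (hPn : ¬ ∃ Q : (W.baseChange (ringClassField K ι n)).toAffine.Point, (2 : ℤ) • Q = d.derivedPoint)
    {L k : ℕ} (hL : 2 * M₀ + 12 ≤ L) (hk : 1 ≤ k)
    {n₀ : ℕ} (hn₀ : Squarefree n₀)
    (hn₀K : ∀ q ∈ n₀.primeFactors, Zhang2014.IsKolyvaginPrime (W.conductorNorm ℤ) W K 2 q ∧ 2 ≤ Zhang2014.kolyvaginIndex W 2 q ∧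
      FrobEqFrobInfty W K (2 ^ 2) q)
    (e₀ : KolyvaginHeegnerData Dt β ι n₀) (he₀ : addOrderOf (e₀.kolyvaginClass Nat.prime_two 2) = 2 ^ 2)
    (hSigma : 2 ≤ ∑ q ∈ (NumberField.discr K).natAbs.primeFactors,
        ((if jacobiSym W.Δ.num q = -1 then 1 else 0) +
          (if jacobiSym W.Δ.num q = 1 ∧ Even (W.frobeniusTrace q) then 2 else 0))) :
    ¬ CMKolyvaginExactAtInertTwo := fun hX ↦ by
  have h := sum_defect_le_one_of_cmKolyvaginExact_of_grossWitness hX hGZ hGZK hmod hMilneC W hCM hin hρ2 hT K hIQ hodd h3 hHe hns₁ hns₂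
    h37 Dt β ι d₁ hy M₀ hM₀ hndiv d hn hKoly hPn hL hk hn₀ hn₀K e₀ he₀
  omega

/-! ## §3 The exact count under a Gross witness: `#Ш(E_K)(2)·2 = 2^{2M₀+Σ}` -/

/-- **`#Ш(E_K)[2^∞] · 2 = 2^{2M₀ + Σ}` ON H₂ FOR EVERY ODD `d_K ≠ −3`, GIVEN A LEVEL-`4` GROSS WITNESS** (modulo GZ / GZK / modularity /
Milne and Gross 3.7 (2) at `(W, K)`): g18's composite upper bound `card_primaryComponent_sha_two_baseChange_mul_two_le_of_printedInputs`
(`#Ш(E_K)(2)·2 ≤ 2^{2M₀}·2^{Σ}`, Kolyvagin's pair bound + g15's count identity) and §2's lower bound.  This is the value BSD predicts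
(`#Ш(E_K)(2) = 2^{2M₀−1}·∏_{q∣d_K} c_q(E^{(d_K)})₂`); it agrees with the crux `CMKolyvaginExactAtInertTwo` (`= 2^{2M₀}`) iff `Σ = 1`.
[cite: McCallumLMS1991, §5 Thm. 5.4, Cor. 5.6] [cite: Kolyvagin1989Izv, §3 (Thm. B_l at l = 2)] [cite: Kramer1981, Prop. 3]
[cite: DokchitserDokchitserAnnals2010, Lemma 4.14 (proof)] [cite: Milne1972ArithmeticAV, Thm. 1] -/
theorem card_primaryComponent_sha_two_baseChange_mul_two_eq_of_grossWitness_of_printedInputs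
    (hGZ : ∀ (N : ℕ) [NeZero N] (W : WeierstrassCurve ℚ) (K : Type) [Field K] [NumberField K], gross_zagier N W K)
    (hGZK : rank_eq_analyticRank_of_analyticRank_le_one) (hmod : hasEntireLFunction_rat)
    (hMilneC : Milne1972.bsdQuotient_baseChange_quadratic_anyModel)
    (W : WeierstrassCurve ℚ) [W.IsElliptic] [W.IsGloballyMinimal] [NeZero (W.conductorNorm ℤ)]
    (hCM : W.HasCM) (hin : Rank1Residual.CMInert W 2) (hρ2 : W.HasSurjectiveModNGaloisRep 2)
    (hT : Odd W.tamagawaProduct) (K : Type) [Field K] [NumberField K] (hIQ : IsImaginaryQuadratic K)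
    (hodd : Odd (NumberField.discr K)) (h3 : NumberField.discr K ≠ -3) (hHe : SatisfiesHeegnerHypothesis (W.conductorNorm ℤ) K)
    (h37 : prop37_2_reductionCongruence_inert (W.conductorNorm ℤ) W K)
    (Dt : ModularParametrizationData W (W.conductorNorm ℤ)) (β : ℤ) (ι : K →+* ℂ) (d₁ : KolyvaginHeegnerData Dt β ι 1)
    (hy : ¬ IsOfFinAddOrder d₁.derivedPoint) (M₀ : ℕ)
    (hM₀ : ∃ Q : (W.baseChange (ringClassField K ι 1)).toAffine.Point, ((2 ^ M₀ : ℕ) : ℤ) • Q = d₁.derivedPoint)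
    (hndiv : ¬ ∃ Q : (W.baseChange (ringClassField K ι 1)).toAffine.Point, ((2 ^ (M₀ + 1) : ℕ) : ℤ) • Q = d₁.derivedPoint)
    {L k : ℕ} (hL : 2 * M₀ + 12 ≤ L) (hk : 1 ≤ k)
    {n₀ : ℕ} (hn₀ : Squarefree n₀)
    (hn₀K : ∀ q ∈ n₀.primeFactors, Zhang2014.IsKolyvaginPrime (W.conductorNorm ℤ) W K 2 q ∧ 2 ≤ Zhang2014.kolyvaginIndex W 2 q ∧
      FrobEqFrobInfty W K (2 ^ 2) q)
    (e₀ : KolyvaginHeegnerData Dt β ι n₀) (he₀ : addOrderOf (e₀.kolyvaginClass Nat.prime_two 2) = 2 ^ 2) :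
    Nat.card (AddCommGroup.primaryComponent (W.baseChange K).sha 2) * 2 =
      2 ^ (2 * M₀ + ∑ q ∈ (NumberField.discr K).natAbs.primeFactors,
        ((if jacobiSym W.Δ.num q = -1 then 1 else 0) +
          (if jacobiSym W.Δ.num q = 1 ∧ Even (W.frobeniusTrace q) then 2 else 0))) := by
  rw [pow_add]
  exact le_antisymm
    (KolyvaginPairSupplyTwo.card_primaryComponent_sha_two_baseChange_mul_two_le_of_printedInputs W hGZ hGZK hmod hMilneC hCM hin hρ2
      hT hIQ hodd h3 hHe h37 Dt β ι d₁ hy M₀ hM₀ hndiv)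
    (pow_mul_pow_sum_defect_le_card_sha_two_baseChange_of_grossWitness_of_printedInputs hGZ hGZK hmod hMilneC W hCM hin hρ2 hT K hIQ
      hodd h3 hHe h37 Dt β ι d₁ hy M₀ hM₀ hndiv hL hk hn₀ hn₀K e₀ he₀)


end Summit.BirchSwinnertonDyer.BirchSwinnertonDyer.Theorems.KolyvaginGenusTwo

end
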